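import Literature.Analysis.FluidPDE.BoltzmannEquation
import HarnessLib

/-!
# Lanford's weighted sup norms: pointwise readings, compactness in time, decaying weights

(Topic MathematicalPhysics/KineticTheory; second layer of the proof of the named fact
`Literature.MathematicalPhysics.KineticTheory.ukai_lanford_bound` — local well-posedness of the
hard-sphere Boltzmann equation in Lanford's class, Gallagher–Saint-Raymond–Texier 2013 Part I
Ch. 2 §3.1 Thm 1, Part II Ch. 5; Ukai 1974.)

Elementary facts about the Gaussian-weighted sup norm
`‖g‖_β = sup_{x,v} e^{β|v|²/2} |g(x,v)|` (`Literature.Analysis.FluidPDE.eGaussSupNorm`, valued in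
`ℝ≥0∞`) and about the time-decaying weights `γ(t) = γ₁ - κ (t - t₁)` of Ukai's trick
(GST 2013 Part II Ch. 5, Def. 5.1.4 and §5.4: "continuity estimates involve a loss … the
parameters β and μ will themselves depend on time"):

* `abs_le_of_eGaussSupNorm_le`, `eGaussSupNorm_le_of_abs_le`,
  `exists_abs_le_of_eGaussSupNorm_lt_top` — `‖g‖_β ≤ M` iff `|g(x, v)| ≤ M e^{-β|v|²/2}`;
* `eGaussSupNorm_add_le` — the triangle inequality;
* `exists_abs_le_of_continuousInLanfordOn` — a density continuous in time on a compact interval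
  with values in `X_β` (`Literature.Analysis.FluidPDE.ContinuousInLanfordOn (Icc a b) β f`) is
  uniformly bounded there: `|f(t, x, v)| ≤ N e^{-β|v|²/2}` for `t ∈ [a, b]` (compactness,
  `IsCompact.induction_on`);
* `one_add_mul_le_add_sqrt`, `integral_exp_neg_mul_le`, `intervalIntegral_weight_le` — the gain
  of the decaying weight against the loss `(1 + |v|)` of the collision operator:
  `∫_{t₁}^{t} (1 + |v|) e^{-γ(τ)|v|²/2} dτ ≤ ((t - t₁) + (2 (t - t₁)/κ)^{1/2}) e^{-γ(t)|v|²/2}`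
  for `γ(τ) = γ₁ - κ (τ - t₁)` (the elementary optimisation behind GST 2013 (5.4.x):
  `(1 + r) m ≤ s + (2s/κ)^{1/2}` whenever `m ≤ s` and `κ r² m ≤ 2`).

No definitions are introduced.

## References

* I. Gallagher, L. Saint-Raymond, B. Texier, *From Newton to Boltzmann: hard spheres and
  short-range potentials*, EMS (2013) = arXiv:1208.5753, Part I Ch. 2 §3.1, Part II Ch. 5
  (Def. 5.1.4, §5.3–5.4).
* S. Ukai, *On the existence of global solutions of mixed problem for non-linear Boltzmann
  equation*, Proc. Japan Acad. 50 (1974) 179–184.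
-/

open MeasureTheory Metric Real Set Filter Topology
open scoped InnerProductSpace ENNReal
open Literature.Analysis.FluidPDE

namespace Literature.MathematicalPhysics.KineticTheory

noncomputable section

/-! ## Pointwise readings of the weighted sup norm -/

section SupNorm

variable {E : Type*} [NormedAddCommGroup E] {X : Type*}

omit [NormedAddCommGroup E] in
/-- `e^{-β|v|²/2} e^{β|v|²/2} = 1`. [folklore] -/
theorem exp_neg_weight_mul_exp_weight [Norm E] (β : ℝ) (v : E) :
    exp (-(β / 2) * ‖v‖ ^ 2) * exp (β / 2 * ‖v‖ ^ 2) = 1 := by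
  rw [← Real.exp_add]
  convert Real.exp_zero using 2
  ring

/-- Pointwise reading of a bound on Lanford's weighted sup norm:
`‖g‖_β ≤ M` gives `|g(x, v)| ≤ M e^{-β|v|²/2}` (GST 2013 Part II Ch. 5, Def. 5.1.1). [cite: GST2013, Part II Ch. 5 Def. 5.1.1] -/
theorem abs_le_of_eGaussSupNorm_le {β : ℝ} {g : X → E → ℝ} {M : ℝ} (hM : 0 ≤ M)
    (h : eGaussSupNorm β g ≤ ENNReal.ofReal M) (x : X) (v : E) :
    |g x v| ≤ M * exp (-(β / 2) * ‖v‖ ^ 2) := by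
  have h1 := (enorm_le_eGaussSupNorm β g x v).trans h
  rw [Real.enorm_eq_ofReal_abs, ← ENNReal.ofReal_mul (exp_pos _).le,
    ENNReal.ofReal_le_ofReal_iff hM] at h1
  calc |g x v| = exp (-(β / 2) * ‖v‖ ^ 2) * (exp (β / 2 * ‖v‖ ^ 2) * |g x v|) := by
        rw [← mul_assoc, exp_neg_weight_mul_exp_weight, one_mul]
    _ ≤ exp (-(β / 2) * ‖v‖ ^ 2) * M := mul_le_mul_of_nonneg_left h1 (exp_pos _).le
    _ = M * exp (-(β / 2) * ‖v‖ ^ 2) := mul_comm _ _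

/-- Conversely, `|g(x, v)| ≤ M e^{-β|v|²/2}` for all `(x, v)` gives `‖g‖_β ≤ M`. [folklore] -/
theorem eGaussSupNorm_le_of_abs_le {β M : ℝ} {g : X → E → ℝ}
    (h : ∀ x v, |g x v| ≤ M * exp (-(β / 2) * ‖v‖ ^ 2)) :
    eGaussSupNorm β g ≤ ENNReal.ofReal M := by
  unfold eGaussSupNorm
  refine iSup_le fun x => iSup_le fun v => ?_
  rw [Real.enorm_eq_ofReal_abs, ← ENNReal.ofReal_mul (exp_pos _).le]
  refine ENNReal.ofReal_le_ofReal ?_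
  calc exp (β / 2 * ‖v‖ ^ 2) * |g x v|
      ≤ exp (β / 2 * ‖v‖ ^ 2) * (M * exp (-(β / 2) * ‖v‖ ^ 2)) :=
        mul_le_mul_of_nonneg_left (h x v) (exp_pos _).le
    _ = M * (exp (-(β / 2) * ‖v‖ ^ 2) * exp (β / 2 * ‖v‖ ^ 2)) := by ring
    _ = M := by rw [exp_neg_weight_mul_exp_weight, mul_one]

/-- A density of finite weighted sup norm admits a real Gaussian bound
`|g(x, v)| ≤ M e^{-β|v|²/2}`, `M = ‖g‖_β ≥ 0`. [folklore] -/
theorem exists_abs_le_of_eGaussSupNorm_lt_top {β : ℝ} {g : X → E → ℝ}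
    (h : eGaussSupNorm β g < ∞) :
    ∃ M : ℝ, 0 ≤ M ∧ ∀ x v, |g x v| ≤ M * exp (-(β / 2) * ‖v‖ ^ 2) :=
  ⟨(eGaussSupNorm β g).toReal, ENNReal.toReal_nonneg,
    abs_le_of_eGaussSupNorm_le ENNReal.toReal_nonneg (ENNReal.ofReal_toReal h.ne).ge⟩

/-- The triangle inequality for Lanford's weighted sup norm. [folklore] -/
theorem eGaussSupNorm_add_le (β : ℝ) (g h : X → E → ℝ) :
    eGaussSupNorm β (g + h) ≤ eGaussSupNorm β g + eGaussSupNorm β h := by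
  unfold eGaussSupNorm
  refine iSup_le fun x => iSup_le fun v => ?_
  calc ENNReal.ofReal (exp (β / 2 * ‖v‖ ^ 2)) * ‖(g + h) x v‖ₑ
      = ENNReal.ofReal (exp (β / 2 * ‖v‖ ^ 2)) * ‖g x v + h x v‖ₑ := rfl
    _ ≤ ENNReal.ofReal (exp (β / 2 * ‖v‖ ^ 2)) * (‖g x v‖ₑ + ‖h x v‖ₑ) :=
        mul_le_mul' le_rfl (enorm_add_le _ _)
    _ = ENNReal.ofReal (exp (β / 2 * ‖v‖ ^ 2)) * ‖g x v‖ₑ +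
          ENNReal.ofReal (exp (β / 2 * ‖v‖ ^ 2)) * ‖h x v‖ₑ := mul_add _ _ _
    _ ≤ _ := add_le_add (enorm_le_eGaussSupNorm β g x v) (enorm_le_eGaussSupNorm β h x v)

/-- **Uniform weighted bound on a compact time interval.** A density `f` that is continuous in
time on `[a, b]` with values in Lanford's space `X_β`
(`Literature.Analysis.FluidPDE.ContinuousInLanfordOn (Icc a b) β f`, GST 2013 Thm 5–6:
`C([0,T]; X_{0,β})`) is uniformly bounded there: `|f(t, x, v)| ≤ N e^{-β|v|²/2}` for all
`t ∈ [a, b]` and `(x, v)`. Proof: `t ↦ ‖f(t)‖_β` is locally bounded (triangle inequality and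
`‖f(t) - f(t₀)‖_β → 0`), hence bounded on the compact interval. [folklore] -/
theorem exists_abs_le_of_continuousInLanfordOn [TopologicalSpace X] {a b β : ℝ}
    {f : ℝ → X → E → ℝ} (hf : ContinuousInLanfordOn (Icc a b) β f) :
    ∃ N : ℝ, 0 ≤ N ∧ ∀ t ∈ Icc a b, ∀ x v, |f t x v| ≤ N * exp (-(β / 2) * ‖v‖ ^ 2) := by
  have key : ∃ C : ℝ≥0∞, C < ∞ ∧ ∀ t ∈ Icc a b, eGaussSupNorm β (f t) ≤ C := by
    refine isCompact_Icc.induction_on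
      (p := fun s => ∃ C : ℝ≥0∞, C < ∞ ∧ ∀ t ∈ s, eGaussSupNorm β (f t) ≤ C) ?_ ?_ ?_ ?_
    · exact ⟨0, ENNReal.zero_lt_top, fun t ht => ht.elim⟩
    · rintro s s' hss' ⟨C, hC, h⟩
      exact ⟨C, hC, fun u hu => h u (hss' hu)⟩
    · rintro s s' ⟨C, hC, h⟩ ⟨C', hC', h'⟩
      refine ⟨max C C', max_lt hC hC', fun u hu => hu.elim (fun hu => ?_) (fun hu => ?_)⟩
      · exact (h u hu).trans (le_max_left _ _)
      · exact (h' u hu).trans (le_max_right _ _)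
    · intro t₀ ht₀
      have hev : ∀ᶠ t in 𝓝[Icc a b] t₀, eGaussSupNorm β (f t - f t₀) < 1 :=
        (tendsto_order.1 (hf.2 t₀ ht₀)).2 1 zero_lt_one
      refine ⟨{t | eGaussSupNorm β (f t - f t₀) < 1}, hev, eGaussSupNorm β (f t₀) + 1, ?_,
        fun t ht => ?_⟩
      · exact ENNReal.add_lt_top.2 ⟨(hf.1 t₀ ht₀).2, ENNReal.one_lt_top⟩
      · calc eGaussSupNorm β (f t) = eGaussSupNorm β (f t₀ + (f t - f t₀)) := by
              rw [add_sub_cancel]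
          _ ≤ eGaussSupNorm β (f t₀) + eGaussSupNorm β (f t - f t₀) := eGaussSupNorm_add_le _ _ _
          _ ≤ eGaussSupNorm β (f t₀) + 1 := add_le_add le_rfl (le_of_lt ht)
  obtain ⟨C, hC, h⟩ := key
  exact ⟨C.toReal, ENNReal.toReal_nonneg, fun t ht x v =>
    abs_le_of_eGaussSupNorm_le ENNReal.toReal_nonneg
      ((h t ht).trans (ENNReal.ofReal_toReal hC.ne).ge) x v⟩

end SupNorm

/-! ## Decaying weights against the loss `(1 + |v|)` -/

section Weights

/-- The elementary optimisation behind Ukai's decaying-weight trick: if `0 ≤ m ≤ s` and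
`κ r² m ≤ 2` (`r, κ > 0`-type quantities), then `(1 + r) m ≤ s + (2s/κ)^{1/2}`
(`(r m)² = (r² m) m ≤ (2/κ) s`; no sign condition on `r` is needed). [folklore] -/
theorem one_add_mul_le_add_sqrt {κ s m r : ℝ} (hκ : 0 < κ)
    (hm0 : 0 ≤ m) (hms : m ≤ s) (hκm : κ * r ^ 2 * m ≤ 2) :
    (1 + r) * m ≤ s + Real.sqrt (2 * s / κ) := by
  have h2 : r ^ 2 * m ≤ 2 / κ := by
    rw [le_div_iff₀ hκ]
    linarith [hκm]
  have h1 : r * m ≤ Real.sqrt (2 * s / κ) := by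
    refine Real.le_sqrt_of_sq_le ?_
    calc (r * m) ^ 2 = (r ^ 2 * m) * m := by ring
      _ ≤ (2 / κ) * m := mul_le_mul_of_nonneg_right h2 hm0
      _ ≤ (2 / κ) * s := mul_le_mul_of_nonneg_left hms (by positivity)
      _ = 2 * s / κ := by ring
  calc (1 + r) * m = m + r * m := by ring
    _ ≤ s + Real.sqrt (2 * s / κ) := add_le_add hms h1

/-- The exponential primitive bounds `0 ≤ ∫₀ˢ e^{-aτ} dτ ≤ s` and `a ∫₀ˢ e^{-aτ} dτ ≤ 1`
(`= 1 - e^{-as}`), for `a, s ≥ 0`. [folklore] -/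
theorem integral_exp_neg_mul_le {a s : ℝ} (ha : 0 ≤ a) (hs : 0 ≤ s) :
    0 ≤ ∫ τ in (0 : ℝ)..s, exp (-a * τ) ∧ (∫ τ in (0 : ℝ)..s, exp (-a * τ)) ≤ s ∧
      a * ∫ τ in (0 : ℝ)..s, exp (-a * τ) ≤ 1 := by
  have hcont : Continuous fun τ : ℝ => exp (-a * τ) := by fun_prop
  refine ⟨intervalIntegral.integral_nonneg hs fun τ _ => (exp_pos _).le, ?_, ?_⟩
  · calc (∫ τ in (0 : ℝ)..s, exp (-a * τ)) ≤ ∫ _τ in (0 : ℝ)..s, (1 : ℝ) := by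
          refine intervalIntegral.integral_mono_on hs (hcont.intervalIntegrable _ _)
            (continuous_const.intervalIntegrable _ _) fun τ hτ => ?_
          rw [exp_le_one_iff]
          nlinarith [hτ.1]
      _ = s := by simp
  · rcases ha.eq_or_lt with h0 | ha'
    · rw [← h0, zero_mul]
      exact zero_le_one
    · have hne : (-a) ≠ 0 := by linarith
      have h := intervalIntegral.integral_comp_mul_left (fun x : ℝ => exp x) hne (a := 0) (b := s)
      rw [h, integral_exp, smul_eq_mul, mul_zero, exp_zero]
      have e : a * ((-a)⁻¹ * (exp (-a * s) - 1)) = 1 - exp (-a * s) := by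
        field_simp
        ring
      rw [e]
      linarith [exp_pos (-a * s)]

/-- **The decaying weight absorbs the loss of the collision operator** (the computation behind
the time `T(β₀, ‖f₀‖)` of GST 2013 Part II Ch. 5, Remark 5.1.5 / proof of Thm 6): for the
weight `γ(τ) = γ₁ - κ (τ - t₁)`, `κ > 0`, `t₁ ≤ t` and any real `r` (`= |v|`),
`∫_{t₁}^{t} (1 + r) e^{-γ(τ) r²/2} dτ ≤ ((t - t₁) + (2(t - t₁)/κ)^{1/2}) e^{-γ(t) r²/2}`.
[cite: GST2013, Part II Ch. 5 Remark 5.1.5] -/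
theorem intervalIntegral_weight_le {κ : ℝ} (hκ : 0 < κ) (γ₁ t₁ t : ℝ) (ht : t₁ ≤ t) (r : ℝ) :
    ∫ τ in t₁..t, (1 + r) * exp (-((γ₁ - κ * (τ - t₁)) / 2) * r ^ 2) ≤
      ((t - t₁) + Real.sqrt (2 * (t - t₁) / κ)) * exp (-((γ₁ - κ * (t - t₁)) / 2) * r ^ 2) := by
  set s : ℝ := t - t₁ with hs_def
  have hs : 0 ≤ s := sub_nonneg.2 ht
  set a : ℝ := κ * r ^ 2 / 2 with ha_def
  have ha : 0 ≤ a := by positivity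
  have hfac : ∀ τ : ℝ, (1 + r) * exp (-((γ₁ - κ * (τ - t₁)) / 2) * r ^ 2) =
      exp (-((γ₁ - κ * (t - t₁)) / 2) * r ^ 2) * ((1 + r) * exp (-a * (t - τ))) := by
    intro τ
    have e : -((γ₁ - κ * (τ - t₁)) / 2) * r ^ 2 =
        -((γ₁ - κ * (t - t₁)) / 2) * r ^ 2 + -a * (t - τ) := by
      rw [ha_def]; ring
    rw [e, Real.exp_add]
    ring
  simp_rw [hfac]
  rw [intervalIntegral.integral_const_mul, mul_comm]
  refine mul_le_mul_of_nonneg_right ?_ (exp_pos _).le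
  rw [intervalIntegral.integral_const_mul]
  have hsub : ∫ τ in t₁..t, exp (-a * (t - τ)) = ∫ u in (0 : ℝ)..s, exp (-a * u) := by
    rw [intervalIntegral.integral_comp_sub_left (fun u => exp (-a * u)) t, sub_self]
  rw [hsub]
  obtain ⟨hm0, hms, ham⟩ := integral_exp_neg_mul_le ha hs
  refine one_add_mul_le_add_sqrt hκ hm0 hms ?_
  have e : κ * r ^ 2 * ∫ u in (0 : ℝ)..s, exp (-a * u) = 2 * (a * ∫ u in (0 : ℝ)..s, exp (-a * u)) := by
    rw [ha_def]; ring
  rw [e]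
  linarith

end Weights

end

end Literature.MathematicalPhysics.KineticTheory
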